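import Mathlib
import Summits.ValiantsHypothesis.ValiantsHypothesis.Theorems.NewtonUnitEquationsNewtonTauWeakKernelBootstrap
import Summits.ValiantsHypothesis.ValiantsHypothesis.Theorems.NewtonUnitEquationsNewtonTauWeakWeightedNormalFormPinned

/-!
# `NewtonUnitEquationsNewtonTauWeakSquareRegime` — the kernel bootstrap and the square regime

Line `binomial-normal-form` of crux `NewtonTauWeak` (stmt-ValiantsHypothesis-5904), STUB-PLAN Tier 1, registered
stubs `kernelBootstrap` (S4) and `weightedLevelSetPoly_of_square` (S5), plus the trivial converse
`square_of_weightedLevelSetPoly`.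

Setting.  Items `j : Fin N` with weights `1 ≤ g j ≤ c` and exponents `d j ∈ ℕ²` (coincidences allowed); the
weight-`v` level set of subset sums is `X_v = {Σ_{j ∈ J} d j : Σ_{j ∈ J} g j = v}`, and `V(N, c)` denotes the
largest number of hull vertices of such a set.

* `kernelBootstrap` (**S4**, `V(N, c) ≤ (4N² + 5) · V(4c², c)`): the composition of `kernelBootstrapOfNF` (the
  count localises to a kernel of `≤ 4c·c` items, fixed inside each cell of the arrangement of the `N²` density
  functionals) with the pinned exchange normal form `weightedNormalForm_pinned`.
* `weightedLevelSetPoly_of_square` (**S5**): hence polynomiality of `V(N, c)` in `(N, c)` is decided in the SQUARE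
  REGIME `N ≤ 4c²`: a bound `(c + 2)^e` there gives `(cN + 2)^(e + 4)` everywhere (`4N² + 5 ≤ (cN + 2)^4`).
* `square_of_weightedLevelSetPoly`: conversely `(cN + 2)^e ≤ (c + 2)^(4e)` when `N ≤ 4c²`.

Folklore arithmetic on top of the two landed rungs; no named facts, no citations, no `def`s.
-/

-- Sub = Summit single-conjunct layout: the duplicated namespace component is mandated by the tree.
set_option linter.dupNamespace false

noncomputable section

open scoped BigOperators

namespace Summit.ValiantsHypothesis.ValiantsHypothesis.Theorems.NewtonUnitEquationsNewtonTauWeak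

namespace SquareRegimeAux

/-- A weighted level set of subset sums on `N` items has at most `2 ^ N` hull vertices (extreme points of the hull
of a finite set belong to the set, which is indexed by subsets of `Fin N`). [folklore] -/
theorem ncard_extremePoints_le_two_pow (N v : ℕ) (g : Fin N → ℕ) (d : Fin N → (Fin 2 →₀ ℕ)) :
    (Set.extremePoints ℝ (convexHull ℝ ((fun e : Fin 2 →₀ ℕ => fun i : Fin 2 => ((e i : ℕ) : ℝ)) ''
      (((Finset.univ.filter fun J : Finset (Fin N) => ∑ j ∈ J, g j = v).image
        fun J => ∑ j ∈ J, d j : Finset (Fin 2 →₀ ℕ)) : Set (Fin 2 →₀ ℕ))))).ncard ≤ 2 ^ N := by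
  classical
  refine (Set.ncard_le_ncard extremePoints_convexHull_subset ((Finset.finite_toSet _).image _)).trans ?_
  refine (Set.ncard_image_le (Finset.finite_toSet _)).trans ?_
  rw [Set.ncard_coe_finset]
  refine Finset.card_image_le.trans ((Finset.card_filter_le _ _).trans ?_)
  rw [Finset.card_univ, Fintype.card_finset, Fintype.card_fin]

/-- `4N² + 5 ≤ (cN + 2)^4` for `c ≥ 1`. [folklore] -/
theorem four_mul_sq_add_five_le (N c : ℕ) (hc : 1 ≤ c) : 4 * (N * N) + 5 ≤ (c * N + 2) ^ 4 := by
  have h1 : N ≤ c * N := Nat.le_mul_of_pos_left N hc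
  have h2 : 4 * (N * N) + 5 ≤ (N + 2) ^ 4 := by
    have : (N + 2) ^ 4 = (N * N + 4 * N + 4) * (N * N + 4 * N + 4) := by ring
    rw [this]
    nlinarith
  exact h2.trans (Nat.pow_le_pow_left (by omega) 4)

end SquareRegimeAux

/-- **Kernel bootstrap `V(N, c) ≤ (4N² + 5) · V(4c², c)`, registered stub `kernelBootstrap` (STUB-PLAN S4).**
For weights `1 ≤ g j ≤ c` and exponents `d j ∈ ℕ²` (`j : Fin N`, coincidences allowed): if every weighted level
set on `n ≤ 4c·c` items with weights in `[1, c]` has at most `B` hull vertices, then the convex hull of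
`X_v = {Σ_{j ∈ J} d j : Σ_{j ∈ J} g j = v}` has at most `(4 (N * N) + 5) · B` extreme points.  Proof:
`kernelBootstrapOfNF` (rank and canonical-set parameters instantiated by their defining lambda terms) fed with the
pinned normal form `weightedNormalForm_pinned`. [folklore] -/
theorem kernelBootstrap (N c v B : ℕ) (g : Fin N → ℕ) (hg : ∀ j, 1 ≤ g j ∧ g j ≤ c)
    (d : Fin N → (Fin 2 →₀ ℕ))
    (hB : ∀ (n v' : ℕ) (g' : Fin n → ℕ) (d' : Fin n → (Fin 2 →₀ ℕ)), n ≤ 4 * c * c →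
      (∀ j, 1 ≤ g' j ∧ g' j ≤ c) →
      (Set.extremePoints ℝ (convexHull ℝ ((fun e : Fin 2 →₀ ℕ => fun i : Fin 2 => ((e i : ℕ) : ℝ)) ''
        (((Finset.univ.filter fun J : Finset (Fin n) => ∑ j ∈ J, g' j = v').image
          fun J => ∑ j ∈ J, d' j : Finset (Fin 2 →₀ ℕ)) : Set (Fin 2 →₀ ℕ))))).ncard ≤ B) :
    (Set.extremePoints ℝ (convexHull ℝ ((fun e : Fin 2 →₀ ℕ => fun i : Fin 2 => ((e i : ℕ) : ℝ)) ''
      (((Finset.univ.filter fun J : Finset (Fin N) => ∑ j ∈ J, g j = v).image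
        fun J => ∑ j ∈ J, d j : Finset (Fin 2 →₀ ℕ)) : Set (Fin 2 →₀ ℕ))))).ncard ≤ (4 * (N * N) + 5) * B := by
  refine kernelBootstrapOfNF N c v B g hg d
    (fun c' j => (Finset.univ.filter fun j' : Fin N =>
        c' j * (g j' : ℝ) < c' j' * (g j : ℝ) ∨ (c' j' * (g j : ℝ) = c' j * (g j' : ℝ) ∧ j' < j)).card)
    (fun _ _ => rfl) _ (fun _ _ _ _ => rfl) ?_ hB
  intro c' J hJ hmax
  obtain ⟨α, β, hsum, -, hKv, hKval⟩ :=
    weightedNormalForm_pinned N c v g hg c' J hJ hmax _ (fun _ => rfl) _ (fun _ _ _ => rfl)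
  exact ⟨α, β, hsum, hKv, hKval⟩

/-- **Polynomiality is decided in the square regime, registered stub `weightedLevelSetPoly_of_square`
(STUB-PLAN S5).**  If the weighted level sets on `N ≤ 4c·c` items with weights in `[1, c]` have at most
`(c + 2)^e` hull vertices, then ALL weighted level sets with weights in `[1, c]` have at most `(cN + 2)^(e + 4)`
hull vertices: for `N ≤ 4c·c` directly (`N = 0`: at most one point), otherwise by `kernelBootstrap` and
`4N² + 5 ≤ (cN + 2)^4`. [folklore] -/
theorem weightedLevelSetPoly_of_square
    (h : ∃ e : ℕ, ∀ (N c v : ℕ) (g : Fin N → ℕ), N ≤ 4 * c * c → (∀ j, 1 ≤ g j ∧ g j ≤ c) →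
      ∀ d : Fin N → (Fin 2 →₀ ℕ),
        (Set.extremePoints ℝ (convexHull ℝ ((fun e : Fin 2 →₀ ℕ => fun i : Fin 2 => ((e i : ℕ) : ℝ)) ''
          (((Finset.univ.filter fun J : Finset (Fin N) => ∑ j ∈ J, g j = v).image
            fun J => ∑ j ∈ J, d j : Finset (Fin 2 →₀ ℕ)) : Set (Fin 2 →₀ ℕ))))).ncard ≤ (c + 2) ^ e) :
    ∃ e : ℕ, ∀ (N c v : ℕ) (g : Fin N → ℕ), (∀ j, 1 ≤ g j ∧ g j ≤ c) → ∀ d : Fin N → (Fin 2 →₀ ℕ),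
      (Set.extremePoints ℝ (convexHull ℝ ((fun e : Fin 2 →₀ ℕ => fun i : Fin 2 => ((e i : ℕ) : ℝ)) ''
        (((Finset.univ.filter fun J : Finset (Fin N) => ∑ j ∈ J, g j = v).image
          fun J => ∑ j ∈ J, d j : Finset (Fin 2 →₀ ℕ)) : Set (Fin 2 →₀ ℕ))))).ncard ≤ (c * N + 2) ^ e := by
  obtain ⟨e, he⟩ := h
  refine ⟨e + 4, fun N c v g hg d => ?_⟩
  have hpos : 1 ≤ c * N + 2 := by omega
  rcases Nat.eq_zero_or_pos N with hN0 | hNpos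
  · -- no items: at most one point
    subst hN0
    refine (SquareRegimeAux.ncard_extremePoints_le_two_pow 0 v g d).trans ?_
    rw [pow_zero]
    exact Nat.one_le_pow _ _ hpos
  have hc : 1 ≤ c := by
    have := hg ⟨0, hNpos⟩
    omega
  have hmono : (c + 2) ^ e ≤ (c * N + 2) ^ e :=
    Nat.pow_le_pow_left (by nlinarith [Nat.le_mul_of_pos_right c hNpos]) e
  by_cases hN : N ≤ 4 * c * c
  · exact ((he N c v g hN hg d).trans hmono).trans (Nat.pow_le_pow_right hpos (Nat.le_add_right e 4))
  · refine (kernelBootstrap N c v ((c + 2) ^ e) g hg d fun n v' g' d' hn hg' => he n c v' g' hn hg' d').trans ?_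
    rw [pow_add, mul_comm ((c * N + 2) ^ e)]
    exact Nat.mul_le_mul (SquareRegimeAux.four_mul_sq_add_five_le N c hc) hmono

/-- **The trivial converse**: a bound `(cN + 2)^e` for all weighted level sets gives `(c + 2)^(4e)` in the square
regime `N ≤ 4c·c`, since `cN + 2 ≤ 4c³ + 2 ≤ (c + 2)^4`. [folklore] -/
theorem square_of_weightedLevelSetPoly
    (h : ∃ e : ℕ, ∀ (N c v : ℕ) (g : Fin N → ℕ), (∀ j, 1 ≤ g j ∧ g j ≤ c) → ∀ d : Fin N → (Fin 2 →₀ ℕ),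
      (Set.extremePoints ℝ (convexHull ℝ ((fun e : Fin 2 →₀ ℕ => fun i : Fin 2 => ((e i : ℕ) : ℝ)) ''
        (((Finset.univ.filter fun J : Finset (Fin N) => ∑ j ∈ J, g j = v).image
          fun J => ∑ j ∈ J, d j : Finset (Fin 2 →₀ ℕ)) : Set (Fin 2 →₀ ℕ))))).ncard ≤ (c * N + 2) ^ e) :
    ∃ e : ℕ, ∀ (N c v : ℕ) (g : Fin N → ℕ), N ≤ 4 * c * c → (∀ j, 1 ≤ g j ∧ g j ≤ c) →
      ∀ d : Fin N → (Fin 2 →₀ ℕ),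
        (Set.extremePoints ℝ (convexHull ℝ ((fun e : Fin 2 →₀ ℕ => fun i : Fin 2 => ((e i : ℕ) : ℝ)) ''
          (((Finset.univ.filter fun J : Finset (Fin N) => ∑ j ∈ J, g j = v).image
            fun J => ∑ j ∈ J, d j : Finset (Fin 2 →₀ ℕ)) : Set (Fin 2 →₀ ℕ))))).ncard ≤ (c + 2) ^ e := by
  obtain ⟨e, he⟩ := h
  refine ⟨4 * e, fun N c v g hN hg d => (he N c v g hg d).trans ?_⟩
  rw [pow_mul]
  refine Nat.pow_le_pow_left ?_ e
  have h1 : c * N ≤ c * (4 * c * c) := Nat.mul_le_mul_left c hN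
  have h2 : (c + 2) ^ 4 = c ^ 4 + 8 * c ^ 3 + 24 * c ^ 2 + 32 * c + 16 := by ring
  rw [h2]
  nlinarith

end Summit.ValiantsHypothesis.ValiantsHypothesis.Theorems.NewtonUnitEquationsNewtonTauWeak

end
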